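import Literature.Barriers.ValiantsHypothesis.GCTMatrixPoweringProp17
import Literature.RepresentationTheory.FiniteGroups.SymmetricGroupFrobeniusFormula
import HarnessLib

/-!
# Gesmundo–Ikenmeyer–Panova 2017, Prop. 17: the "only if" directions and the discharge
# `GIP2017_prop17_holds` of the named fact

Sibling file (D-0014) of `GCTMatrixPoweringColumns.lean` (named fact `GIP2017_prop17`, an iff:
"`sm(1^a, ℓ) > 0` if and only if `a ∉ X_s` and `am(1^a, ℓ) > 0` if and only if `a ∉ X_a`",
`ℓ = max{⌊√a⌋ + 2, 12}`), `GCTMatrixPoweringProp17.lean` (the "if" directions,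
`GIP2017_prop17_if`), `GCTMatrixPoweringColumnSign.lean` (Thm. 16, positivity halves) and
`GCTMatrixPoweringSemigroup.lean` (`kroneckerCoeff_eq_finrank_add_finrank`: `g = sk + ak` as
dimensions; `skCharSum_eq_card_mul_finrank`, `akCharSum_eq_card_mul_finrank`). Conventions as there.

GIP (p. 10): "Using character theory it is easy to show that `g(π, λ, λᵗ) = 1` for `π = |λ| × 1`.
Using eq. (3.1) we know that only one of two cases can occur: Either `sk(π,λ) = 1` and `ak(π,λ) = 0`
or `sk(π,λ) = 0` and `ak(π,λ) = 1`" and (proof of Prop. 17) "a direct calculation shows that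
`sm(1^a, ℓ) = 0` for `a ∈ X_s` and `am(1^a, ℓ) = 0` for `a ∈ X_a`".

**What this file proves** (no `sorry`, no new definition or named fact; net debt −1):

1. `S^{(d)}` is the trivial representation (`spechtRep_indiscrete_apply`: `u · c_{(d)} = ε(u) c_{(d)}`),
   `χ^{(d)} ≡ 1` (`spechtCharacter_indiscrete`, via `∑_σ χ^{(d)}(σ)² = d!`), and
   **`g((d), μ, ν) = [μ = ν]`** (`kroneckerCoeff_indiscrete_eq`: the character formula
   `kroneckerCoeff_eq_sum_spechtCharacter_holds`, Mathlib's `Representation.char_orthonormal` with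
   the tree's `isIrreducible_spechtRep_holds`, `nonempty_equiv_iff_holds`, `spechtCharacter_inv`);
   hence **`g(1^d, μ, ν) = [ν = μᵗ]`** (`kroneckerCoeff_column_eq`, transposition property).
2. **Thm. 16, the vanishing halves**: `sk(1^d, μ) = ak(1^d, μ) = 0` for `μ ≠ μᵗ`
   (`not_skPos_and_not_akPos_column_of_ne`); for `μ = μᵗ`, `sk > 0` excludes `ak > 0`
   (`not_akPos_column_of_skPos`, `g = 1 = dim Sym-invariants + dim Alt-invariants`); so
   `sk(1^d, μ) = 0` unless `μ = μᵗ`, `sgn(μ) = 1` (`not_skPos_column`) and `ak(1^d, μ) = 0` unless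
   `μ = μᵗ`, `sgn(μ) = -1` (`not_akPos_column`).
3. Durfee size `d(μ)` of a self-conjugate `μ ⊢ D` (`exists_durfee`): `d ≥ 1`, `d² ≤ D`, and
   `D ≡ d (mod 2)` (`durfee_modEq`: the diagonal reflection is an involution with `d` fixed points;
   Mathlib's `Equiv.Perm.card_compl_support_modEq`), so `sgn(μ) = (-1)^{(D-d)/2}` is determined by
   `d ∈ {1, 2, 3}` for `D ≤ 14`: every self-conjugate `μ ⊢ a` has `sgn(μ) = -1` for `a ∈ X_s` and
   `sgn(μ) = 1` for `a ∈ X_a` (`sign_transposePerm_of_mem_gipXs`, `…_gipXa`) — the printed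
   "direct calculation".
4. **`GIP2017_prop17_holds : GIP2017_prop17`**.

## References

* [GesmundoIkenmeyerPanova2017] F. Gesmundo, C. Ikenmeyer, G. Panova, *Geometric complexity theory
  and matrix powering*, Diff. Geom. Appl. 55 (2017) 106–127 = arXiv:1611.00827: §3 (the paragraph
  before Thm. 16; Thm. 16; Prop. 17 and its proof).
* [FultonHarrisGTM129] W. Fulton, J. Harris, *Representation Theory*, GTM 129: §4.1 (`c_{(d)}`,
  `V_{(d)}` the trivial representation), Exercise 4.51 (character formula for Kronecker coefficients),
  §2.2 (orthonormality of irreducible characters).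
-/

noncomputable section

open scoped BigOperators

namespace Literature.Barriers.ValiantsHypothesis

open Literature.NumberTheory.DiophantineGeometry Literature.Computability.Complexity Finset
open Literature.RepresentationTheory.FiniteGroups (sum_spechtCharacter_mul_self)

/-! ### 1. The one-row Specht module is the trivial representation; `g((d), μ, ν) = [μ = ν]` -/

section OneRow

variable {d : ℕ}

open scoped Classical in
/-- `u · a_{(d)} = ε(u) a_{(d)}`: the full symmetrizer `a_{(d)} = ∑_{τ ∈ 𝔖_d} τ` absorbs left
multiplication through the augmentation. [cite: FultonHarrisGTM129, §4.1 (after (4.3): c_{(d)} = Σ_g e_g)] -/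
theorem mul_rowSymmetrizer_indiscrete (u : MonoidAlgebra ℂ (Equiv.Perm (Fin d))) :
    u * rowSymmetrizer ℂ (Nat.Partition.indiscrete d) =
      augmentation ℂ d u • rowSymmetrizer ℂ (Nat.Partition.indiscrete d) := by
  set s := rowSymmetrizer ℂ (Nat.Partition.indiscrete d) with hs
  have hs' : s = ∑ τ : Equiv.Perm (Fin d), MonoidAlgebra.of ℂ _ τ := by
    rw [hs, rowSymmetrizer, rowStabilizer_indiscrete]
    exact Finset.sum_congr (by ext τ; simp) fun _ _ => rfl
  -- both sides are `ℂ`-linear in `u`; check on group elements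
  have hof : ∀ g : Equiv.Perm (Fin d), MonoidAlgebra.of ℂ _ g * s = s := by
    intro g
    rw [hs', Finset.mul_sum]
    simp only [← map_mul]
    exact Fintype.sum_equiv (Equiv.mulLeft g) _ _ fun τ => rfl
  induction u using MonoidAlgebra.induction_on with
  | hM g =>
    rw [hof, augmentation_of, one_smul]
  | hadd x y hx hy => rw [add_mul, hx, hy, map_add, add_smul]
  | hsmul r x hx => rw [smul_mul_assoc, hx, map_smul, smul_eq_mul, mul_smul]

/-- `u · c_{(d)} = ε(u) c_{(d)}` for the Young symmetrizer of the one-row shape. [cite: FultonHarrisGTM129, §4.1] -/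
theorem mul_youngSymmetrizer_indiscrete (u : MonoidAlgebra ℂ (Equiv.Perm (Fin d))) :
    u * youngSymmetrizer ℂ (Nat.Partition.indiscrete d) =
      augmentation ℂ d u • youngSymmetrizer ℂ (Nat.Partition.indiscrete d) := by
  rw [youngSymmetrizer, ← mul_assoc, mul_rowSymmetrizer_indiscrete, smul_mul_assoc]

/-- **`S^{(d)}` is the trivial representation**: every `σ` acts as the identity on
`k[𝔖_d] c_{(d)} = k · c_{(d)}`. [cite: FultonHarrisGTM129, §4.1 (V_{(d)} = trivial representation)] -/
theorem spechtRep_indiscrete_apply (σ : Equiv.Perm (Fin d))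
    (x : spechtIdeal ℂ (Nat.Partition.indiscrete d)) :
    spechtRep ℂ (Nat.Partition.indiscrete d) σ x = x := by
  apply Subtype.ext
  rw [spechtRep_apply]
  obtain ⟨a, ha⟩ := Ideal.mem_span_singleton'.mp x.2
  rw [← ha, ← mul_assoc, mul_youngSymmetrizer_indiscrete, mul_youngSymmetrizer_indiscrete a,
    augmentation_of_mul]

/-- The character of `S^{(d)}` is constant: `χ^{(d)}(σ) = χ^{(d)}(1)`. [cite: FultonHarrisGTM129, §4.1] -/
theorem spechtCharacter_indiscrete_eq (σ : Equiv.Perm (Fin d)) :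
    spechtCharacter ℂ (Nat.Partition.indiscrete d) σ =
      spechtCharacter ℂ (Nat.Partition.indiscrete d) 1 := by
  rw [spechtCharacter_apply, spechtCharacter_apply]
  congr 1
  ext x
  rw [spechtRep_indiscrete_apply, map_one, Module.End.one_apply]

/-- **`χ^{(d)} ≡ 1`** (the trivial character): constant, and `∑_σ χ^{(d)}(σ)² = d!`
(orthonormality, `sum_spechtCharacter_mul_self`) forces the constant, a dimension, to be `1`.
[cite: FultonHarrisGTM129, §4.1] -/
theorem spechtCharacter_indiscrete (σ : Equiv.Perm (Fin d)) :
    spechtCharacter ℂ (Nat.Partition.indiscrete d) σ = 1 := by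
  rw [spechtCharacter_indiscrete_eq]
  set f := spechtCharacter ℂ (Nat.Partition.indiscrete d) 1 with hf
  have hnat : f = (Module.finrank ℂ (spechtIdeal ℂ (Nat.Partition.indiscrete d)) : ℂ) := by
    rw [hf, spechtCharacter_eq_character, Representation.char_one]
  have hsum := sum_spechtCharacter_mul_self (Nat.Partition.indiscrete d)
  simp_rw [spechtCharacter_indiscrete_eq, Finset.sum_const, Finset.card_univ, Fintype.card_perm,
    Fintype.card_fin, nsmul_eq_mul] at hsum
  have hfac : (d.factorial : ℂ) ≠ 0 := Nat.cast_ne_zero.mpr (Nat.factorial_ne_zero d)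
  have hff : f * f = 1 := by
    have := mul_left_cancel₀ hfac (hsum.trans (mul_one _).symm)
    exact this
  -- `f` is a natural number with `f² = 1`
  set m := Module.finrank ℂ (spechtIdeal ℂ (Nat.Partition.indiscrete d)) with hm
  rw [hnat] at hff ⊢
  have hmm : m * m = 1 := by exact_mod_cast hff
  have hm1 : m = 1 := by
    rcases Nat.eq_zero_or_pos m with h0 | hpos
    · rw [h0] at hmm; simp at hmm
    · nlinarith
  rw [hm1, Nat.cast_one]

/-- **`g((d), μ, ν) = [μ = ν]`**: `d! g((d), μ, ν) = ∑_σ χ^{(d)} χ^μ χ^ν = ∑_σ χ^μ(σ) χ^ν(σ⁻¹)`,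
which is `d!` or `0` by the orthonormality of the irreducible Specht characters (Mathlib's
`Representation.char_orthonormal` with the tree's `isIrreducible_spechtRep_holds`,
`nonempty_equiv_iff_holds`). [cite: FultonHarrisGTM129, §4.1 and Exercise 4.51] -/
theorem kroneckerCoeff_indiscrete_eq (mu nu : Nat.Partition d) :
    kroneckerCoeff ℂ (Nat.Partition.indiscrete d) mu nu = if mu = nu then 1 else 0 := by
  classical
  haveI : (spechtRep ℂ mu).IsIrreducible := isIrreducible_spechtRep_holds (k := ℂ) mu
  haveI : (spechtRep ℂ nu).IsIrreducible := isIrreducible_spechtRep_holds (k := ℂ) nu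
  have hcard_pos : (Nat.card (Equiv.Perm (Fin d)) : ℂ) ≠ 0 := Nat.cast_ne_zero.2 Nat.card_pos.ne'
  letI : Invertible (Nat.card (Equiv.Perm (Fin d)) : ℂ) := invertibleOfNonzero hcard_pos
  have horth := Representation.char_orthonormal (spechtRep ℂ mu) (spechtRep ℂ nu)
  have hcardk : (Nat.card (Equiv.Perm (Fin d)) : ℂ) = (d.factorial : ℂ) := by
    rw [Nat.card_eq_fintype_card, Fintype.card_perm, Fintype.card_fin]
  have hg := kroneckerCoeff_eq_sum_spechtCharacter_holds ℂ (Nat.Partition.indiscrete d) mu nu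
  simp_rw [spechtCharacter_indiscrete, one_mul] at hg
  have h1 : ∑ σ : Equiv.Perm (Fin d), spechtCharacter ℂ mu σ * spechtCharacter ℂ nu σ =
      ∑ σ : Equiv.Perm (Fin d), (spechtRep ℂ mu).character σ * (spechtRep ℂ nu).character σ⁻¹ := by
    refine Finset.sum_congr rfl fun σ _ => ?_
    rw [← spechtCharacter_eq_character, ← spechtCharacter_eq_character, spechtCharacter_inv]
  rw [h1] at hg
  have h2 := congr_arg (fun z => (Nat.card (Equiv.Perm (Fin d)) : ℂ) * z) horth
  simp only [← mul_assoc, mul_inv_cancel₀ hcard_pos, one_mul] at h2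
  rw [h2, hcardk] at hg
  have hiff : Nonempty ((spechtRep ℂ nu).Equiv (spechtRep ℂ mu)) ↔ mu = nu := by
    rw [nonempty_equiv_iff_holds (k := ℂ)]
    exact eq_comm
  have hfac : (d.factorial : ℂ) ≠ 0 := Nat.cast_ne_zero.mpr (Nat.factorial_ne_zero d)
  by_cases hmn : mu = nu
  · rw [if_pos (hiff.mpr hmn)] at hg
    rw [if_pos hmn]
    have : ((d.factorial * kroneckerCoeff ℂ (Nat.Partition.indiscrete d) mu nu : ℕ) : ℂ) =
        ((d.factorial * 1 : ℕ) : ℂ) := by rw [hg]; push_cast; ring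
    exact Nat.eq_of_mul_eq_mul_left (Nat.factorial_pos d) (Nat.cast_injective this)
  · rw [if_neg (fun h => hmn (hiff.mp h))] at hg
    rw [if_neg hmn]
    have : ((d.factorial * kroneckerCoeff ℂ (Nat.Partition.indiscrete d) mu nu : ℕ) : ℂ) =
        ((d.factorial * 0 : ℕ) : ℂ) := by rw [hg]; push_cast; ring
    exact Nat.eq_of_mul_eq_mul_left (Nat.factorial_pos d) (Nat.cast_injective this)

/-- **`g(1^d, μ, ν) = [ν = μᵗ]`** (`g(1^d, μ, ν) = g((d), μᵗ, ν)`, transposition property; GIP p. 10: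
"Using character theory it is easy to show that `g(π, λ, λᵗ) = 1` for `π = |λ| × 1`").
[cite: GesmundoIkenmeyerPanova2017, §3 (before Thm. 16)] -/
theorem kroneckerCoeff_column_eq (mu nu : Nat.Partition d) :
    kroneckerCoeff ℂ (Nat.Partition.column d) mu nu = if mu.transpose = nu then 1 else 0 := by
  rw [kroneckerCoeff_transpose₁₂ ℂ, ← transpose_indiscrete, Nat.Partition.transpose_transpose,
    kroneckerCoeff_indiscrete_eq]

end OneRow

/-! ### 2. Thm. 16, the vanishing halves: `sk(1^d, μ) = 0` unless `μ = μᵗ` with `sgn(μ) = 1`, etc. -/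

section Vanishing

variable {d : ℕ}

/-- `sk(1^d, μ) = ak(1^d, μ) = 0` unless `μ` is self-conjugate (`g(1^d, μ, μ) = [μ = μᵗ]`).
[cite: GesmundoIkenmeyerPanova2017, §3 (before Thm. 16)] -/
theorem not_skPos_and_not_akPos_column_of_ne (mu : Nat.Partition d) (h : mu.transpose ≠ mu) :
    ¬ SkPos (Nat.Partition.column d) mu ∧ ¬ AkPos (Nat.Partition.column d) mu := by
  have hg : kroneckerCoeff ℂ (Nat.Partition.column d) mu mu = 0 := by
    rw [kroneckerCoeff_column_eq, if_neg h]
  constructor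
  · intro hsk
    have := kroneckerCoeff_pos_of_skPos hsk
    omega
  · intro hak
    have := kroneckerCoeff_pos_of_akPos hak
    omega

/-- **Thm. 16, exclusivity**: for self-conjugate `μ`, `g(1^d, μ, μ) = 1 = sk + ak`, so `sk(1^d, μ) > 0`
excludes `ak(1^d, μ) > 0` ("only one of two cases can occur: Either `sk(π,λ) = 1` and `ak(π,λ) = 0`
or `sk(π,λ) = 0` and `ak(π,λ) = 1`"). [cite: GesmundoIkenmeyerPanova2017, §3 (before Thm. 16) and Thm. 16] -/
theorem not_akPos_column_of_skPos (mu : Nat.Partition d) (hsk : SkPos (Nat.Partition.column d) mu) :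
    ¬ AkPos (Nat.Partition.column d) mu := by
  intro hak
  obtain ⟨N, hl, hm, -, -, -, -⟩ := exists_parts_card_le₆ (Nat.Partition.column d) mu mu mu mu mu
  have hg : kroneckerCoeff ℂ (Nat.Partition.column d) mu mu ≤ 1 := by
    rw [kroneckerCoeff_column_eq]; split_ifs <;> omega
  rw [SkPos, skCharSum_eq_card_mul_finrank _ mu hl hm, mul_ne_zero_iff, Nat.cast_ne_zero,
    Nat.cast_ne_zero] at hsk
  rw [AkPos, akCharSum_eq_card_mul_finrank _ mu hl hm, mul_ne_zero_iff, Nat.cast_ne_zero,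
    Nat.cast_ne_zero] at hak
  rw [kroneckerCoeff_eq_finrank_add_finrank _ mu hl hm] at hg
  omega

/-- Symmetrically, `ak(1^d, μ) > 0` excludes `sk(1^d, μ) > 0`. [cite: GesmundoIkenmeyerPanova2017, Thm. 16] -/
theorem not_skPos_column_of_akPos (mu : Nat.Partition d) (hak : AkPos (Nat.Partition.column d) mu) :
    ¬ SkPos (Nat.Partition.column d) mu :=
  fun hsk => not_akPos_column_of_skPos mu hsk hak

/-- **Thm. 16, vanishing of `sk`**: `sk(1^d, μ) = 0` unless `μ = μᵗ` and `sgn(μ) = 1`.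
[cite: GesmundoIkenmeyerPanova2017, Thm. 16] -/
theorem not_skPos_column (mu : Nat.Partition d)
    (h : mu.transpose ≠ mu ∨ Equiv.Perm.sign mu.transposePerm = -1) :
    ¬ SkPos (Nat.Partition.column d) mu := by
  by_cases hself : mu.transpose = mu
  · rcases h with h | h
    · exact absurd hself h
    · exact not_skPos_column_of_akPos mu (akPos_column_of_sign_eq_neg_one mu hself h)
  · exact (not_skPos_and_not_akPos_column_of_ne mu hself).1

/-- **Thm. 16, vanishing of `ak`**: `ak(1^d, μ) = 0` unless `μ = μᵗ` and `sgn(μ) = -1`.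
[cite: GesmundoIkenmeyerPanova2017, Thm. 16] -/
theorem not_akPos_column (mu : Nat.Partition d)
    (h : mu.transpose ≠ mu ∨ Equiv.Perm.sign mu.transposePerm = 1) :
    ¬ AkPos (Nat.Partition.column d) mu := by
  by_cases hself : mu.transpose = mu
  · rcases h with h | h
    · exact absurd hself h
    · exact not_akPos_column_of_skPos mu (skPos_column_of_sign_eq_one mu hself h)
  · exact (not_skPos_and_not_akPos_column_of_ne mu hself).2

end Vanishing

/-! ### 3. Durfee size of a self-conjugate partition: `d ≥ 1`, `d² ≤ |μ|`, `|μ| ≡ d (mod 2)` -/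

section Durfee

variable {D : ℕ}

/-- The Durfee size of `μ` read off the rows: the rows `r` with `μ_{r+1} > r` form an initial
segment `r < d(μ)`. [folklore] -/
theorem exists_durfee (μ : Nat.Partition D) :
    ∃ dur, dur ≤ μ.parts.card ∧ ∀ r, r < μ.sortedParts.getD r 0 ↔ r < dur := by
  classical
  have hex : ∃ n, ¬ n < μ.sortedParts.getD n 0 :=
    ⟨μ.parts.card, by rw [getD_sortedParts_eq_zero μ (le_refl μ.parts.card)]; exact Nat.not_lt_zero _⟩
  refine ⟨Nat.find hex, Nat.find_min' hex (by
    rw [getD_sortedParts_eq_zero μ (le_refl μ.parts.card)]; exact Nat.not_lt_zero _), fun r => ?_⟩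
  constructor
  · intro hr
    by_contra hge
    have hP : Nat.find hex < μ.sortedParts.getD (Nat.find hex) 0 :=
      lt_of_le_of_lt (not_lt.mp hge)
        (lt_of_lt_of_le hr (antitone_getD_sortedParts μ (not_lt.mp hge)))
    exact Nat.find_spec hex hP
  · intro hr
    by_contra hP
    exact Nat.find_min hex hr hP

/-- A nonempty partition has positive Durfee size. [folklore] -/
theorem durfee_pos (μ : Nat.Partition D) (hD : 0 < D) {dur : ℕ}
    (hd : ∀ r, r < μ.sortedParts.getD r 0 ↔ r < dur) : 0 < dur := by
  rw [← hd 0, ← sup_parts_eq_getD_sortedParts]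
  have hne : μ.parts ≠ 0 := by
    intro h0
    have := μ.parts_sum
    rw [h0, Multiset.sum_zero] at this
    omega
  obtain ⟨c, hc⟩ := Multiset.exists_mem_of_ne_zero hne
  exact lt_of_lt_of_le (μ.parts_pos hc) (Multiset.le_sup hc)

/-- **The Durfee square fits**: `d(μ)² ≤ |μ|` (the first `d` rows have at least `d` boxes each).
[folklore] -/
theorem durfee_sq_le (μ : Nat.Partition D) {dur : ℕ}
    (hd : ∀ r, r < μ.sortedParts.getD r 0 ↔ r < dur) : dur * dur ≤ D := by
  rcases Nat.eq_zero_or_pos dur with rfl | hpos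
  · simp
  have hrow : ∀ r < dur, dur ≤ μ.sortedParts.getD r 0 := by
    intro r hr
    have h1 : dur - 1 < μ.sortedParts.getD (dur - 1) 0 := (hd _).mpr (by omega)
    have h2 : μ.sortedParts.getD (dur - 1) 0 ≤ μ.sortedParts.getD r 0 :=
      antitone_getD_sortedParts μ (by omega)
    omega
  have hK : dur ≤ μ.parts.card := by
    by_contra hlt
    have h0 := getD_sortedParts_eq_zero μ (le_refl μ.parts.card)
    have := hrow (μ.parts.card) (not_le.mp hlt)
    omega
  calc dur * dur = ∑ r ∈ range dur, dur := by rw [Finset.sum_const, Finset.card_range, smul_eq_mul]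
    _ ≤ ∑ r ∈ range dur, μ.sortedParts.getD r 0 := Finset.sum_le_sum fun r hr =>
        hrow r (Finset.mem_range.mp hr)
    _ ≤ ∑ r ∈ range μ.parts.card, μ.sortedParts.getD r 0 :=
        Finset.sum_le_sum_of_subset (Finset.range_subset_range.mpr hK)
    _ = D := sum_range_getD_sortedParts_of_le μ le_rfl

/-- **`|μ| ≡ d(μ) (mod 2)` for self-conjugate `μ`**: the diagonal reflection `π_μ` is an involution
of the `D` entries whose fixed points are the `d(μ)` diagonal ones (Mathlib's
`Equiv.Perm.card_compl_support_modEq`). [cite: GesmundoIkenmeyerPanova2017, §3 ("Since λ is self-conjugate, this number is even")] -/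
theorem durfee_modEq (μ : Nat.Partition D) (hself : μ.transpose = μ) {dur : ℕ}
    (hd : ∀ r, r < μ.sortedParts.getD r 0 ↔ r < dur) : D ≡ dur [MOD 2] := by
  classical
  haveI : Fact (Nat.Prime 2) := ⟨Nat.prime_two⟩
  have hsq : μ.transposePerm ^ 2 ^ 1 = 1 := by
    rw [pow_one, sq]; exact transposePerm_mul_self hself
  have hmod := Equiv.Perm.card_compl_support_modEq hsq
  rw [Fintype.card_fin] at hmod
  have hdK : dur ≤ μ.parts.card := by
    by_contra hlt
    have h0 := getD_sortedParts_eq_zero μ (le_refl μ.parts.card)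
    have := (hd μ.parts.card).mpr (not_le.mp hlt)
    omega
  have hcard : μ.transposePerm.supportᶜ.card = dur := by
    have h1 : μ.transposePerm.supportᶜ =
        Finset.univ.filter fun i : Fin D => μ.rowOf i = μ.colOf i := by
      ext i
      rw [Finset.mem_compl, Equiv.Perm.mem_support, not_not, Finset.mem_filter,
        transposePerm_apply_eq_self_iff μ hself]
      simp
    rw [h1, card_filter_rowOf_eq_colOf μ le_rfl]
    have hf : (Finset.range μ.parts.card).filter (fun r => r < μ.sortedParts.getD r 0) =
        Finset.range dur := by
      ext r
      simp only [Finset.mem_filter, Finset.mem_range, hd]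
      omega
    rw [hf, Finset.card_range]
  rw [hcard] at hmod
  exact hmod.symm

end Durfee

/-! ### 4. The "direct calculation" for `a ∈ X_s`, `a ∈ X_a`, and `GIP2017_prop17_holds` -/

section Prop17

/-- **Every self-conjugate `μ ⊢ a`, `a ∈ X_s = {2,3,4,7,8,12}`, has `sgn(μ) = -1`** (its Durfee size
`d` has `d² ≤ a`, `d ≡ a (mod 2)`, so `d = 1, 2, 2, 1, 2, 2` and `(a-d)/2 = ·, 1, 1, 3, 3, 5` is odd;
`a = 2` has no self-conjugate partition). [cite: GesmundoIkenmeyerPanova2017, Prop. 17 (proof: "a direct calculation shows that sm(1^a, ℓ) = 0 for a ∈ X_s")] -/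
theorem sign_transposePerm_of_mem_gipXs {a : ℕ} (ha : a ∈ gipXs) (μ : Nat.Partition a)
    (hself : μ.transpose = μ) : Equiv.Perm.sign μ.transposePerm = -1 := by
  obtain ⟨dur, hdK, hd⟩ := exists_durfee μ
  have ha' : 0 < a := by
    simp only [gipXs, Finset.mem_insert, Finset.mem_singleton] at ha; omega
  have hpos := durfee_pos μ ha' hd
  have hsq := durfee_sq_le μ hd
  have hmod := durfee_modEq μ hself hd
  have hsign := sign_transposePerm_of_rows μ hself le_rfl hdK hd
  have h3 : dur ≤ 3 := by
    by_contra h4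
    have : 4 * 4 ≤ dur * dur := Nat.mul_le_mul (by omega) (by omega)
    simp only [gipXs, Finset.mem_insert, Finset.mem_singleton] at ha
    omega
  rw [hsign]
  simp only [gipXs, Finset.mem_insert, Finset.mem_singleton] at ha
  interval_cases dur <;> rcases ha with rfl | rfl | rfl | rfl | rfl | rfl <;>
    first | decide | exact absurd hmod (by decide) | omega

/-- **Every self-conjugate `μ ⊢ a`, `a ∈ X_a = {1,2,5,6,10,14}`, has `sgn(μ) = 1`** (`d = 1, ·, 1, 2, 2, 2`,
`(a-d)/2 = 0, ·, 2, 2, 4, 6` even). [cite: GesmundoIkenmeyerPanova2017, Prop. 17 (proof: "am(1^a, ℓ) = 0 for a ∈ X_a")] -/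
theorem sign_transposePerm_of_mem_gipXa {a : ℕ} (ha : a ∈ gipXa) (μ : Nat.Partition a)
    (hself : μ.transpose = μ) : Equiv.Perm.sign μ.transposePerm = 1 := by
  obtain ⟨dur, hdK, hd⟩ := exists_durfee μ
  have ha' : 0 < a := by
    simp only [gipXa, Finset.mem_insert, Finset.mem_singleton] at ha; omega
  have hpos := durfee_pos μ ha' hd
  have hsq := durfee_sq_le μ hd
  have hmod := durfee_modEq μ hself hd
  have hsign := sign_transposePerm_of_rows μ hself le_rfl hdK hd
  have h3 : dur ≤ 3 := by
    by_contra h4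
    have : 4 * 4 ≤ dur * dur := Nat.mul_le_mul (by omega) (by omega)
    simp only [gipXa, Finset.mem_insert, Finset.mem_singleton] at ha
    omega
  rw [hsign]
  simp only [gipXa, Finset.mem_insert, Finset.mem_singleton] at ha
  interval_cases dur <;> rcases ha with rfl | rfl | rfl | rfl | rfl | rfl <;>
    first | decide | exact absurd hmod (by decide) | omega

/-- **GIP Prop. 17 — discharge of the named fact.** "Let `ℓ := max{⌊√a⌋ + 2, 12}`. We have that
`sm(1^a, ℓ) > 0` if and only if `a ∉ X_s` and `am(1^a, ℓ) > 0` if and only if `a ∉ X_a`" (`a ≥ 1`).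
"If": `GIP2017_prop17_if` (Thm. 16 on explicit self-conjugate partitions). "Only if": every
`μ ⊢ a` has `sk(1^a, μ) = 0` for `a ∈ X_s` (non-self-conjugate `μ` by `g(1^a, μ, μ) = 0`,
self-conjugate `μ` by `sgn(μ) = -1` and the exclusivity in Thm. 16), and likewise `ak(1^a, μ) = 0`
for `a ∈ X_a`. [cite: GesmundoIkenmeyerPanova2017, Prop. 17] -/
theorem GIP2017_prop17_holds : GIP2017_prop17 := by
  intro a ha
  refine ⟨⟨fun hsm hmem => ?_, (GIP2017_prop17_if a ha).1⟩,
    ⟨fun ham hmem => ?_, (GIP2017_prop17_if a ha).2⟩⟩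
  · obtain ⟨μ, -, hsk⟩ := hsm
    by_cases hself : μ.transpose = μ
    · exact not_skPos_column μ (Or.inr (sign_transposePerm_of_mem_gipXs hmem μ hself)) hsk
    · exact not_skPos_column μ (Or.inl hself) hsk
  · obtain ⟨μ, -, hak⟩ := ham
    by_cases hself : μ.transpose = μ
    · exact not_akPos_column μ (Or.inr (sign_transposePerm_of_mem_gipXa hmem μ hself)) hak
    · exact not_akPos_column μ (Or.inl hself) hak

end Prop17

end Literature.Barriers.ValiantsHypothesis

end
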